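import Summits.ResolutionOfSingularities.ResolutionOfSingularities.Theorems.FrobeniusLadderFInjectiveMacaulayficationMonomialChartPresentationRange
import Summits.ResolutionOfSingularities.ResolutionOfSingularities.Theorems.FrobeniusLadderFInjectiveMacaulayficationPrimeTransfer
import Mathlib.RingTheory.Ideal.Quotient.Operations
import HarnessLib

/-!
# Monomial chart presentation (C1), part 2: the kernel of the chart map and the presentation
(crux `FInjectiveMacaulayfication`, CN engine chain CRUX-PLAN v6 §1.3, piece (C1) `MonomialChartPresentation`)

[OURS · L1 W4.5a] Support file for crux stmt-ResolutionOfSingularities-15315.  Continues `MonomialChartPresentationRange`: for the chart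
map `Ψ : k[Y] → R̄[1/x̄^m]`, `Y_i ↦ x̄^{a i}/x̄^m` (`R̄ = k[X]/(f)`, `θ f = Y^d · g`), §1 `dvd_of_dvd_monomial_mul` (a polynomial divisible by
no variable can be cancelled against monomials), §2 `psi_g_eq_zero` (`(g) ⊆ ker Ψ`, using that `Ψ(Y^d)` is a unit when `x^{Σ dᵢ • a i}`
divides a power of `x^m`) and `dvd_of_psi_eq_zero` (`ker Ψ ⊆ (g)`: clear denominators, pull back along the injective `θ`, cancel the
monomial), §3 **`exists_monomialChartPresentation`**: a bijective ring homomorphism `k[Y]/(g) → R̄[I_A R̄/x̄^m]` onto the affine blow-up algebra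
(a ring isomorphism via `RingEquiv.ofBijective`; stated as bijective hom to keep the subalgebra's ring structure canonical),
sending `ȳ^{V e_j}` to `x̄_j/1` (indeed `θ q ↦ q̄/1`).  No definition is declared; AI-written, weaker than expert review; no statement of
[claim: Hironaka2017] is used. [folklore: affine toric charts of monomial blow-ups, Cox–Little–Schenck §2.3/§10]
-/

-- single-problem summit: the doubled namespace component is forced
set_option linter.dupNamespace false

noncomputable section

namespace Summit.ResolutionOfSingularities.ResolutionOfSingularities.Theorems.FInjectiveMacaulayfication.MonomialChartPresentationKernel

open MvPolynomial
open Summit.ResolutionOfSingularities.ResolutionOfSingularities.Theorems.FInjectiveMacaulayfication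

variable {n : ℕ} {k : Type} [Field k]

/-! ## §1 Cancelling monomials -/

/-- **Cancelling monomials**: if no variable divides `g` and `g ∣ Y^e · h` then `g ∣ h`. [folklore] -/
theorem dvd_of_dvd_monomial_mul {g h : MvPolynomial (Fin n) k} (hcop : ∀ i : Fin n, ¬ (X i ∣ g)) (e : Fin n →₀ ℕ)
    (hdvd : g ∣ monomial e (1 : k) * h) : g ∣ h := by
  classical
  rw [monomial_eq, C_1, one_mul, Finsupp.prod_fintype _ _ (fun i => by simp)] at hdvd
  have key : ∀ s : Finset (Fin n), g ∣ (∏ i ∈ s, (X i : MvPolynomial (Fin n) k) ^ e i) * h → g ∣ h := by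
    intro s
    induction s using Finset.induction_on with
    | empty => intro hd; rwa [Finset.prod_empty, one_mul] at hd
    | insert i s hi ih =>
      intro hd
      rw [Finset.prod_insert hi, mul_assoc] at hd
      exact ih (PrimeTransfer.dvd_of_dvd_X_pow_mul (i := i)
        (fun hm => hcop i (Ideal.mem_span_singleton.mp hm)) hd)
  exact key Finset.univ hdvd

/-! ## §2 The kernel of `Ψ` -/

section Kernel

variable (f : MvPolynomial (Fin n) k) (V : Matrix (Fin n) (Fin n) ℕ) (hV : IsUnit (V.map (Nat.cast : ℕ → ℤ)).det)
  (m : Fin n →₀ ℕ) (a : Fin n → (Fin n →₀ ℕ))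
  (hgen : ∀ i : Fin n, (Finsupp.equivFunOnFinite.symm (V.mulVec ⇑(a i)) : Fin n →₀ ℕ) =
    Finsupp.equivFunOnFinite.symm (V.mulVec ⇑m) + Finsupp.single i 1)
  (d : Fin n →₀ ℕ) (g : MvPolynomial (Fin n) k)
  (hg : aeval (fun j : Fin n => ∏ i : Fin n, (X i : MvPolynomial (Fin n) k) ^ V i j) f = monomial d (1 : k) * g)

/-- `Ψ (C r · q) = (r̄/1) · Ψ q`-type bookkeeping: `Ψ (monomial c r) · (x̄^m/1)^{|c|} = (r • x^{Σ cᵢ • a i})‾/1`. [folklore] -/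
theorem psi_monomial_coeff_mul_pow (c : Fin n →₀ ℕ) (r : k) :
    aeval (fun i : Fin n => algebraMap (MvPolynomial (Fin n) k ⧸ Ideal.span {f})
        (Localization.Away (Ideal.Quotient.mk (Ideal.span {f}) (monomial m (1 : k))))
        (Ideal.Quotient.mk (Ideal.span {f}) (monomial (a i) (1 : k))) *
      IsLocalization.Away.invSelf (Ideal.Quotient.mk (Ideal.span {f}) (monomial m (1 : k)))) (monomial c r) *
      (algebraMap (MvPolynomial (Fin n) k ⧸ Ideal.span {f})
        (Localization.Away (Ideal.Quotient.mk (Ideal.span {f}) (monomial m (1 : k))))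
        (Ideal.Quotient.mk (Ideal.span {f}) (monomial m (1 : k)))) ^ (∑ i : Fin n, c i) =
      algebraMap (MvPolynomial (Fin n) k ⧸ Ideal.span {f})
        (Localization.Away (Ideal.Quotient.mk (Ideal.span {f}) (monomial m (1 : k))))
        (Ideal.Quotient.mk (Ideal.span {f}) (monomial (∑ i : Fin n, c i • a i) r)) := by
  set R := MvPolynomial (Fin n) k ⧸ Ideal.span {f}
  set u : R := Ideal.Quotient.mk (Ideal.span {f}) (monomial m (1 : k)) with hu
  set L := Localization.Away u
  have h1 := MonomialChartPresentationRange.psi_monomial_mul_pow f m a c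
  have hcr : (monomial c r : MvPolynomial (Fin n) k) = C r * monomial c 1 := by rw [C_mul_monomial, mul_one]
  have hcr' : (monomial (∑ i : Fin n, c i • a i) r : MvPolynomial (Fin n) k) = C r * monomial (∑ i : Fin n, c i • a i) 1 := by
    rw [C_mul_monomial, mul_one]
  rw [hcr, map_mul, mul_assoc, h1, hcr', map_mul, map_mul, aeval_C, IsScalarTower.algebraMap_apply k R L]
  congr 1

include hV hgen hg

/-- **`(g) ⊆ ker Ψ`**: `Ψ g = 0`, provided `x^{Σ dᵢ • a i}` divides a power of `x^m` (`hunit`, decidable per specimen: then `Ψ(Y^d)` is a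
unit, and `Ψ(Y^d) Ψ(g) = Ψ(θ f) = f̄/1 = 0`). [folklore] -/
theorem psi_g_eq_zero (hunit : ∃ (N : ℕ) (r : Fin n →₀ ℕ), N • m = ∑ i : Fin n, d i • a i + r) :
    aeval (fun i : Fin n => algebraMap (MvPolynomial (Fin n) k ⧸ Ideal.span {f})
        (Localization.Away (Ideal.Quotient.mk (Ideal.span {f}) (monomial m (1 : k))))
        (Ideal.Quotient.mk (Ideal.span {f}) (monomial (a i) (1 : k))) *
      IsLocalization.Away.invSelf (Ideal.Quotient.mk (Ideal.span {f}) (monomial m (1 : k)))) g = 0 := by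
  set R := MvPolynomial (Fin n) k ⧸ Ideal.span {f}
  set u : R := Ideal.Quotient.mk (Ideal.span {f}) (monomial m (1 : k)) with hu
  set L := Localization.Away u
  set Ψ : MvPolynomial (Fin n) k →ₐ[k] L := aeval (fun i : Fin n => algebraMap R L
    (Ideal.Quotient.mk (Ideal.span {f}) (monomial (a i) (1 : k))) * IsLocalization.Away.invSelf u) with hΨ
  obtain ⟨N, r, hNr⟩ := hunit
  have hU1 : IsUnit (algebraMap R L u) := IsLocalization.Away.algebraMap_isUnit u
  -- `Ψ(Y^d)` is a unit
  have hmono : IsUnit (Ψ (monomial d (1 : k))) := by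
    have h1 := MonomialChartPresentationRange.psi_monomial_mul_pow f m a d
    have h2 : IsUnit (algebraMap R L (Ideal.Quotient.mk (Ideal.span {f}) (monomial (∑ i : Fin n, d i • a i) (1 : k)))) := by
      refine isUnit_of_mul_isUnit_left (y := algebraMap R L (Ideal.Quotient.mk (Ideal.span {f}) (monomial r (1 : k)))) ?_
      rw [← map_mul, ← map_mul, monomial_mul, mul_one, ← hNr, ← one_pow N, ← monomial_pow, map_pow, map_pow]
      exact hU1.pow N
    rw [← h1] at h2
    exact isUnit_of_mul_isUnit_left h2
  -- `Ψ(Y^d) Ψ(g) = Ψ(θ f) = 0`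
  have h0 : Ψ (monomial d (1 : k)) * Ψ g = 0 := by
    rw [← map_mul, ← hg, hΨ, MonomialChartPresentationRange.psi_theta f V hV m a hgen f,
      Ideal.Quotient.eq_zero_iff_mem.mpr (Ideal.mem_span_singleton_self f), map_zero]
  exact (hmono.mul_right_eq_zero).mp h0

omit hV in
/-- **`ker Ψ ⊆ (g)`**: if `Ψ h = 0` then `g ∣ h`, provided no variable divides `g` (`hcop`).  Proof: with `D ≥ |c|` for all monomials `Y^c`
of `h`, `(x̄^m/1)^D Ψ(h) = H̄/1` for `H = Σ_c h_c x^{ε_c}`, and `θ H = Y^{D • E m} h`; `H̄/1 = 0` gives `(x^m)^N H ∈ (f)`, and applying `θ`,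
`Y^d g ∣ Y^{(N+D) • E m} h`, whence `g ∣ h`. [folklore] -/
theorem dvd_of_psi_eq_zero (hcop : ∀ i : Fin n, ¬ (X i ∣ g)) (h : MvPolynomial (Fin n) k)
    (hh : aeval (fun i : Fin n => algebraMap (MvPolynomial (Fin n) k ⧸ Ideal.span {f})
        (Localization.Away (Ideal.Quotient.mk (Ideal.span {f}) (monomial m (1 : k))))
        (Ideal.Quotient.mk (Ideal.span {f}) (monomial (a i) (1 : k))) *
      IsLocalization.Away.invSelf (Ideal.Quotient.mk (Ideal.span {f}) (monomial m (1 : k)))) h = 0) :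
    g ∣ h := by
  classical
  set R := MvPolynomial (Fin n) k ⧸ Ideal.span {f}
  set u : R := Ideal.Quotient.mk (Ideal.span {f}) (monomial m (1 : k)) with hu
  set L := Localization.Away u
  set Ψ : MvPolynomial (Fin n) k →ₐ[k] L := aeval (fun i : Fin n => algebraMap R L
    (Ideal.Quotient.mk (Ideal.span {f}) (monomial (a i) (1 : k))) * IsLocalization.Away.invSelf u) with hΨ
  set θ : MvPolynomial (Fin n) k →ₐ[k] MvPolynomial (Fin n) k :=
    aeval (fun j : Fin n => ∏ i : Fin n, (X i : MvPolynomial (Fin n) k) ^ V i j) with hθ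
  set Em : Fin n →₀ ℕ := Finsupp.equivFunOnFinite.symm (V.mulVec ⇑m) with hEm
  -- the bound `D` and the numerator `H`
  set D : ℕ := h.support.sup (fun c => ∑ i : Fin n, c i) with hD
  have hDle : ∀ c ∈ h.support, ∑ i : Fin n, c i ≤ D := fun c hc => Finset.le_sup (f := fun c => ∑ i : Fin n, c i) hc
  set H : MvPolynomial (Fin n) k :=
    ∑ c ∈ h.support, monomial (∑ i : Fin n, c i • a i + (D - ∑ i : Fin n, c i) • m) (coeff c h) with hH
  -- (A) `Ψ h · U^D = H̄/1`
  have hA : Ψ h * algebraMap R L u ^ D = algebraMap R L (Ideal.Quotient.mk (Ideal.span {f}) H) := by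
    conv_lhs => rw [h.as_sum, map_sum, Finset.sum_mul]
    rw [hH, map_sum, map_sum]
    refine Finset.sum_congr rfl fun c hc => ?_
    have hR : ∀ j : ℕ, Ideal.Quotient.mk (Ideal.span {f}) (monomial (∑ i : Fin n, c i • a i) (coeff c h)) * u ^ j =
        Ideal.Quotient.mk (Ideal.span {f}) (monomial (∑ i : Fin n, c i • a i + j • m) (coeff c h)) := fun j => by
      rw [hu, ← map_pow, ← map_mul, monomial_pow, one_pow, monomial_mul, mul_one]
    rw [← Nat.add_sub_of_le (hDle c hc), pow_add, ← mul_assoc, hΨ, psi_monomial_coeff_mul_pow f m a c (coeff c h),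
      Nat.add_sub_cancel_left, ← map_pow, ← map_mul, hR]
  -- (B) `θ H = Y^{D • E m} · h`
  have hB : θ H = monomial (D • Em) (1 : k) * h := by
    rw [hH, map_sum]
    conv_rhs => rw [h.as_sum, Finset.mul_sum]
    refine Finset.sum_congr rfl fun c hc => ?_
    rw [hθ, ToricChartFedder.theta_monomial, MonomialChartPresentationRange.expMap_eps V m a hgen c D (hDle c hc),
      monomial_mul, one_mul]
  -- `Ψ h = 0` ⇒ `H̄/1 = 0` ⇒ `u^N H̄ = 0` ⇒ `f ∣ (x^m)^N H`
  rw [hh, zero_mul] at hA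
  obtain ⟨⟨uN, huN'⟩, hN⟩ := (IsLocalization.map_eq_zero_iff (Submonoid.powers u) L _).mp hA.symm
  obtain ⟨N, huN⟩ := (Submonoid.mem_powers_iff _ _).mp huN'
  simp only at hN
  rw [← huN, hu, ← map_pow, ← map_mul, Ideal.Quotient.eq_zero_iff_mem, Ideal.mem_span_singleton] at hN
  -- apply `θ`
  have hθN := map_dvd θ hN
  rw [map_mul, map_pow, hg, hB, hθ, ToricChartFedder.theta_monomial, ← hEm] at hθN
  -- `g ∣ Y^d g θ(q) = (Y^{Em})^N Y^{D Em} h`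
  have hgd : g ∣ (monomial Em (1 : k)) ^ N * (monomial (D • Em) (1 : k) * h) :=
    dvd_trans (Dvd.intro_left _ rfl) hθN
  rw [← mul_assoc, monomial_pow, one_pow, monomial_mul, one_mul] at hgd
  exact dvd_of_dvd_monomial_mul hcop _ hgd

end Kernel

/-! ## §3 The presentation -/

section Presentation

variable (f : MvPolynomial (Fin n) k) (V : Matrix (Fin n) (Fin n) ℕ) (hV : IsUnit (V.map (Nat.cast : ℕ → ℤ)).det)
  (m : Fin n →₀ ℕ) (a : Fin n → (Fin n →₀ ℕ))
  (hgen : ∀ i : Fin n, (Finsupp.equivFunOnFinite.symm (V.mulVec ⇑(a i)) : Fin n →₀ ℕ) =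
    Finsupp.equivFunOnFinite.symm (V.mulVec ⇑m) + Finsupp.single i 1)
  (A : Finset (Fin n →₀ ℕ)) (haA : ∀ i, a i ∈ A)
  (hge : ∀ e ∈ A, (Finsupp.equivFunOnFinite.symm (V.mulVec ⇑m) : Fin n →₀ ℕ) ≤
    Finsupp.equivFunOnFinite.symm (V.mulVec ⇑e))
  (d : Fin n →₀ ℕ) (g : MvPolynomial (Fin n) k)
  (hg : aeval (fun j : Fin n => ∏ i : Fin n, (X i : MvPolynomial (Fin n) k) ^ V i j) f = monomial d (1 : k) * g)
  (hunit : ∃ (N : ℕ) (r : Fin n →₀ ℕ), N • m = ∑ i : Fin n, d i • a i + r)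
  (hcop : ∀ i : Fin n, ¬ (X i ∣ g))
include hV hgen haA hge hg hunit hcop

/-- **MONOMIAL CHART PRESENTATION (C1).**  Data: `V` unimodular (rows = the chart's rays), `E e = V·e`; the chart vertex `m` and the
chart exponents `a i` with `E (a i) = E m + e_i`, all in the generator set `A` of the monomial centre `I_A = (x^e : e ∈ A)`, with the
chart inequalities `E m ≤ E e` (`e ∈ A`); `θ f = Y^d · g` with `x^{Σ dᵢ • a i} ∣ (x^m)^N` and no variable dividing `g`.  Conclusion: a BIJECTIVE ring
homomorphism (i.e. a ring isomorphism, `RingEquiv.ofBijective`) `k[Y]/(g) → R̄[I_A R̄ / x̄^m]` (`R̄ = k[X]/(f)`, the affine blow-up algebra of `Literature…AffineBlowupAlgebra`) which is the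
chart map on representatives: `q(Y) ↦ Ψ q`, `Yᵢ ↦ x̄^{a i}/x̄^m`; in particular `θ q ↦ q̄/1` and `Y^{V e_j} ↦ x̄_j/1`. [folklore] -/
theorem exists_monomialChartPresentation :
    ∃ e : (MvPolynomial (Fin n) k ⧸ Ideal.span {g}) →+*
        ↥(Literature.AlgebraicGeometry.Resolution.blowupAlgebra
          (Ideal.span ((fun e : Fin n →₀ ℕ => Ideal.Quotient.mk (Ideal.span {f}) (monomial e (1 : k))) '' (A : Set _)))
          (Ideal.Quotient.mk (Ideal.span {f}) (monomial m (1 : k)))),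
      Function.Bijective e ∧
      (∀ q : MvPolynomial (Fin n) k, (e (Ideal.Quotient.mk (Ideal.span {g}) q)).val =
        aeval (fun i : Fin n => algebraMap (MvPolynomial (Fin n) k ⧸ Ideal.span {f})
          (Localization.Away (Ideal.Quotient.mk (Ideal.span {f}) (monomial m (1 : k))))
          (Ideal.Quotient.mk (Ideal.span {f}) (monomial (a i) (1 : k))) *
          IsLocalization.Away.invSelf (Ideal.Quotient.mk (Ideal.span {f}) (monomial m (1 : k)))) q) ∧
      (∀ q : MvPolynomial (Fin n) k, (e (Ideal.Quotient.mk (Ideal.span {g})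
          (aeval (fun j : Fin n => ∏ i : Fin n, (X i : MvPolynomial (Fin n) k) ^ V i j) q))).val =
        algebraMap (MvPolynomial (Fin n) k ⧸ Ideal.span {f})
          (Localization.Away (Ideal.Quotient.mk (Ideal.span {f}) (monomial m (1 : k))))
          (Ideal.Quotient.mk (Ideal.span {f}) q)) := by
  set R := MvPolynomial (Fin n) k ⧸ Ideal.span {f}
  set u : R := Ideal.Quotient.mk (Ideal.span {f}) (monomial m (1 : k)) with hu
  set L := Localization.Away u
  set Ψ : MvPolynomial (Fin n) k →ₐ[k] L := aeval (fun i : Fin n => algebraMap R L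
    (Ideal.Quotient.mk (Ideal.span {f}) (monomial (a i) (1 : k))) * IsLocalization.Away.invSelf u) with hΨ
  set B := Literature.AlgebraicGeometry.Resolution.blowupAlgebra
    (Ideal.span ((fun e : Fin n →₀ ℕ => Ideal.Quotient.mk (Ideal.span {f}) (monomial e (1 : k))) '' (A : Set _))) u with hB
  have hrange : Set.range (Ψ : MvPolynomial (Fin n) k → L) = (B : Set L) :=
    MonomialChartPresentationRange.range_psi_eq_blowupAlgebra f V hV m a hgen A haA hge
  have hmemB : ∀ q, Ψ q ∈ B := fun q => by
    rw [← SetLike.mem_coe, ← hrange]; exact ⟨q, rfl⟩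
  -- the corestriction of `Ψ` to `B` (built by hand so that `↥B` carries its default ring structure)
  obtain ⟨ψB, hψBval⟩ : ∃ ψ : MvPolynomial (Fin n) k →+* ↥B, ∀ q, (ψ q).val = Ψ q :=
    ⟨{ toFun := fun q => ⟨Ψ q, hmemB q⟩
       map_one' := Subtype.ext (by simp)
       map_mul' := fun x y => Subtype.ext (by simp)
       map_zero' := Subtype.ext (by simp)
       map_add' := fun x y => Subtype.ext (by simp) }, fun q => rfl⟩
  have hsurj : Function.Surjective ψB := by
    rintro ⟨y, hy⟩
    rw [← SetLike.mem_coe, ← hrange] at hy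
    obtain ⟨q, rfl⟩ := hy
    exact ⟨q, Subtype.ext (hψBval q)⟩
  have hker : RingHom.ker ψB = Ideal.span {g} := by
    apply le_antisymm
    · intro h hh
      rw [RingHom.mem_ker, Subtype.ext_iff, hψBval] at hh
      exact Ideal.mem_span_singleton.mpr (dvd_of_psi_eq_zero f V m a hgen d g hg hcop h hh)
    · rw [Ideal.span_le, Set.singleton_subset_iff, SetLike.mem_coe, RingHom.mem_ker, Subtype.ext_iff, hψBval]
      exact psi_g_eq_zero f V hV m a hgen d g hg hunit
  have hvan : ∀ h ∈ Ideal.span {g}, ψB h = 0 := fun h hh => by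
    rw [← hker] at hh
    exact hh
  have hinj : Function.Injective (Ideal.Quotient.lift (Ideal.span {g}) ψB hvan) :=
    RingHom.lift_injective_of_ker_le_ideal (Ideal.span {g}) hvan hker.le
  have hsφ : Function.Surjective (Ideal.Quotient.lift (Ideal.span {g}) ψB hvan) :=
    Ideal.Quotient.lift_surjective_of_surjective (Ideal.span {g}) hvan hsurj
  have hev : ∀ q : MvPolynomial (Fin n) k,
      (Ideal.Quotient.lift (Ideal.span {g}) ψB hvan) (Ideal.Quotient.mk (Ideal.span {g}) q) = ψB q := fun q =>
    Ideal.Quotient.lift_mk _ _ _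
  have hpt : ∀ q : MvPolynomial (Fin n) k,
      Ψ (aeval (fun j : Fin n => ∏ i : Fin n, (X i : MvPolynomial (Fin n) k) ^ V i j) q) =
        algebraMap R L (Ideal.Quotient.mk (Ideal.span {f}) q) := fun q =>
    MonomialChartPresentationRange.psi_theta f V hV m a hgen q
  refine ⟨Ideal.Quotient.lift (Ideal.span {g}) ψB hvan, ⟨hinj, hsφ⟩, fun q => ?_, fun q => ?_⟩
  · rw [hev, hψBval]
  · rw [hev, hψBval]
    exact hpt q

end Presentation

end Summit.ResolutionOfSingularities.ResolutionOfSingularities.Theorems.FInjectiveMacaulayfication.MonomialChartPresentationKernel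

end
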